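import Literature.NumberTheory.Sieve.GallagherGoodLevels
import Literature.NumberTheory.Sieve.PrimesInAPGallagherRangeHolds
import Literature.NumberTheory.LFunctions.RHWave0
import Mathlib.NumberTheory.DirichletCharacter.Orthogonality
import HarnessLib

/-!
# Route `LeeYangFibres`, crux `RelativeDimOne` (stmt-Parity-14113), line `floating-level-core` (lead seat a1):
# the Linnik-range character prime number theorem from the no-Siegel-zero region

The analytic input of stub (A) `stub_flatSecondMoment : NoSiegelZeros → LowClassSecondMomentFlat` of the checked
skeleton `Cruxes/RelativeDimOne/Lines/floating_level_core.lean`, isolated as a tool file (helper hook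
`linnikCharSum_of_noSiegelZeros`). Everything here is PROVED from tree theorems:

* `noExceptionalZero_of_noSiegelZeros` — under rh.S34 `Literature.NumberTheory.LFunctions.NoSiegelZeros`
  (constant `c_S`), NO datum is exceptional in the sense of Montgomery–Vaughan 1975 / Gallagher 1970
  (`IsExceptionalZero c P r χ β`: a real zero `β ∈ [1 − c/log P, 1)` of a primitive `χ ≠ χ₀` mod `r ≤ P`) at any level
  `P ≥ 4`, as soon as the threshold `c` is below `min(c_Page/2, c_S/2)`: by Page's theorem (the tree's
  `exists_exceptionalZero_unique`, MV I Cor. 11.8–11.10) such a zero belongs to a quadratic character, `r ≥ 3`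
  (there is no primitive `χ ≠ χ₀` mod `1` or `2`), and `β ≥ 1 − c/log P > 1 − c_S/log r` is excluded by rh.S34.
* `linnikCharSum_of_noSiegelZeros` — hence the first clause of the tree's UNCONDITIONAL Gallagher prime number
  theorem with adjustable threshold (`gallagher_nonexceptional_threshold`, `GallagherGoodLevels.lean`: explicit
  formulae + the first part of Bombieri's log-free density theorem) applies at EVERY level `P = N^{θ₁}`,
  `0 < θ₁ ≤ θ₀`, over ALL primitive characters; per modulus `d ≤ N^{θ₁}` (embedding `χ ↦ (f, χ⋆)` of the
  characters mod `d` into the primitive characters of conductor `≤ P`,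
  `PrimesInAPGallagher.sum_conductor_primitiveCharacter_le_filter`) this reads
  `Σ_{χ mod d} ‖Σ_{p ≤ N} χ⋆(p) log p − [χ = χ₀] N‖ ≤ K e^{−c/θ₁} N` for `N ≥ N₀(θ₁)`.
  The level is consumed ONLY through `e^{−c/θ₁}` — the floating-level mechanism of the line.

References: Gallagher, Invent. Math. 11 (1970), Thm 7 [Gallagher1970]; Montgomery–Vaughan, Acta Arith. 27 (1975),
§4 Lemmas 4.1, 4.3 [MontgomeryVaughanActa1975]; Montgomery–Vaughan, *Multiplicative Number Theory I*, Cor.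
11.8–11.10 [MontgomeryVaughan2007]; Davenport, *Multiplicative Number Theory*, ch. 14 [DavenportMNT1980].
-/

noncomputable section

open Finset Real Filter
open Literature.NumberTheory.Sieve Literature.NumberTheory.Sieve.MontgomeryVaughan1975
open Literature.NumberTheory.LFunctions (NoSiegelZeros)

namespace Summit.Parity.GeneralizedHardyLittlewood.Cruxes.RelativeDimOne.FloatingLevelCore

/-! ### No exceptional datum under rh.S34 -/

/-- There is no primitive character `χ ≠ χ₀` of modulus `1` or `2` (the character groups are trivial). -/
theorem eq_one_of_level_le_two {r : ℕ} [NeZero r] (hr : r ≤ 2) (χ : DirichletCharacter ℂ r) : χ = 1 := by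
  have hcard : Nat.card (DirichletCharacter ℂ r) = 1 := by
    rw [DirichletCharacter.card_eq_totient_of_hasEnoughRootsOfUnity ℂ r]
    have hr0 : r ≠ 0 := NeZero.ne r
    interval_cases r
    · exact absurd rfl hr0
    · rfl
    · rfl
  have hsub : Subsingleton (DirichletCharacter ℂ r) := (Nat.card_eq_one_iff_unique.mp hcard).1
  exact Subsingleton.elim _ _

/-- **No exceptional datum under rh.S34.** If `NoSiegelZeros` holds (constant `c_S`) then there is `c₁ > 0`
(`= min(c_Page/2, c_S/2)`) such that for every threshold `0 < c ≤ c₁` and every level `P ≥ 4` no datum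
`(r, χ, β)` is exceptional at `(c, P)` in the sense of Montgomery–Vaughan 1975, §4: a real zero `β ≥ 1 − c/log P`
of a primitive `χ ≠ χ₀` mod `r ≤ P` would belong to a quadratic character by Page's theorem
(`exists_exceptionalZero_unique`), with `r ≥ 3`, and `β > 1 − c_S/log r` contradicts rh.S34.
[cite: MontgomeryVaughan2007, Corollaries 11.8–11.10 (Landau–Page)] -/
theorem noExceptionalZero_of_noSiegelZeros (hS : NoSiegelZeros) :
    ∃ c₁ : ℝ, 0 < c₁ ∧ ∀ c : ℝ, 0 < c → c ≤ c₁ → ∀ P : ℝ, 4 ≤ P →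
      ∀ (r : ℕ) [NeZero r] (χ : DirichletCharacter ℂ r) (β : ℝ), ¬ IsExceptionalZero c P r χ β := by
  obtain ⟨cU, hcU, hU⟩ := exists_exceptionalZero_unique
  obtain ⟨cS, hcS, hSz⟩ := hS
  refine ⟨min (cU / 2) (cS / 2), lt_min (by positivity) (by positivity), ?_⟩
  intro c hc hc₁ P hP r _ χ β hexc
  obtain ⟨hprim, hne, hrP, hβ, hβ1, hL⟩ := hexc
  have hcU' : c < cU := by linarith [min_le_left (cU / 2) (cS / 2)]
  have hcS' : c < cS := by linarith [min_le_right (cU / 2) (cS / 2)]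
  have hlogP : 0 < Real.log P := Real.log_pos (by linarith)
  -- Page: the zero belongs to a quadratic character
  have hsq : χ ^ 2 = 1 := by
    have h1 : 1 - cU / Real.log P < ((β : ℂ)).re := by
      rw [Complex.ofReal_re]
      have : c / Real.log P < cU / Real.log P := div_lt_div_of_pos_right hcU' hlogP
      linarith
    exact ((hU P hP).1 r χ hne hrP (β : ℂ) hL (by rw [Complex.ofReal_im, abs_zero]; linarith) h1).1
  have hquad : χ.IsQuadratic := MulChar.isQuadratic_iff_sq_eq_one.mpr hsq
  -- `r ≥ 3`
  have hr3 : 3 ≤ r := by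
    by_contra h
    exact hne (eq_one_of_level_le_two (by omega) χ)
  -- rh.S34 at `σ = β`
  have hr0 : (0 : ℝ) < r := by exact_mod_cast (show 0 < r by omega)
  have hlogr : 0 < Real.log r := Real.log_pos (by exact_mod_cast (show 1 < r by omega))
  have hlogrP : Real.log r ≤ Real.log P := Real.log_le_log hr0 hrP
  have hσ : 1 - cS / Real.log r < β := by
    have h1 : cS / Real.log P ≤ cS / Real.log r := div_le_div_of_nonneg_left hcS.le hlogr hlogrP
    have h2 : c / Real.log P < cS / Real.log P := div_lt_div_of_pos_right hcS' hlogP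
    linarith
  exact hSz r hr3 χ hquad hprim β hσ hL

/-! ### Gallagher's bound over all primitive characters, per modulus, at every small level -/

/-- **The Linnik-range character sum bound from rh.S34** (helper hook of stub `stub_flatSecondMoment`, line
`floating-level-core` of crux stmt-Parity-14113): under `NoSiegelZeros` there are absolute `c, θ₀, K > 0` such that
for every level exponent `0 < θ₁ ≤ θ₀` there is `N₀` with
`Σ_{χ mod d} ‖Σ_{p ≤ N} χ⋆(p) log p − [χ = χ₀]·N‖ ≤ K e^{−c/θ₁} N` for all `N ≥ N₀` and all moduli `1 ≤ d ≤ N^{θ₁}`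
(`χ⋆` the primitive character inducing `χ`; the `χ₀`-term is `|ϑ(N) − N|`). From the tree's unconditional
Gallagher theorem with adjustable threshold (`gallagher_nonexceptional_threshold`) — whose exceptional clause is
void by `noExceptionalZero_of_noSiegelZeros` — at `x = h = N`, `P = N^{θ₁}`, and the embedding of the characters
mod `d` into the primitive characters of conductor `≤ P`. [cite: Gallagher1970, Theorem 7] -/
theorem linnikCharSum_of_noSiegelZeros :
    Literature.NumberTheory.LFunctions.NoSiegelZeros → ∃ c : ℝ, 0 < c ∧ ∃ θ₀ : ℝ, 0 < θ₀ ∧ ∃ K : ℝ, 0 < K ∧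
      ∀ θ₁ : ℝ, 0 < θ₁ → θ₁ ≤ θ₀ → ∃ N₀ : ℕ, ∀ N : ℕ, N₀ ≤ N →
        ∀ (d : ℕ) [NeZero d], (d : ℝ) ≤ (N : ℝ) ^ θ₁ →
          ∑ χ : DirichletCharacter ℂ d,
              ‖Literature.NumberTheory.Sieve.MontgomeryVaughan1975.gallagherTerm χ.primitiveCharacter N N‖ ≤
            K * Real.exp (-c / θ₁) * N := by
  classical
  intro hS
  obtain ⟨c₀, hc₀, c₄, hc₄, hG⟩ := gallagher_nonexceptional_threshold
  obtain ⟨c₁, hc₁, hE⟩ := noExceptionalZero_of_noSiegelZeros hS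
  set c : ℝ := min c₀ c₁ with hcdef
  have hc : 0 < c := lt_min hc₀ hc₁
  obtain ⟨C, hC⟩ := hG c hc (min_le_left _ _)
  refine ⟨c, hc, c₄, hc₄, 2 * (max C 0 + 1), by positivity, fun θ₁ hθ₁ hθ₁c₄ => ?_⟩
  -- threshold: `N ≥ 2`, `log N ≥ 1/θ₁²` (so `exp √log N ≤ N^{θ₁}`), `N^{θ₁} ≥ 4`
  refine ⟨max 2 (max ⌈Real.exp (1 / θ₁ ^ 2)⌉₊ ⌈(4 : ℝ) ^ (1 / θ₁)⌉₊), fun N hN d _ hdP => ?_⟩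
  have hN2 : 2 ≤ N := le_of_max_le_left hN
  have hNexp : ⌈Real.exp (1 / θ₁ ^ 2)⌉₊ ≤ N := le_of_max_le_left (le_of_max_le_right hN)
  have hN4 : ⌈(4 : ℝ) ^ (1 / θ₁)⌉₊ ≤ N := le_of_max_le_right (le_of_max_le_right hN)
  have hN1 : (1 : ℝ) ≤ N := by exact_mod_cast (show 1 ≤ N by omega)
  have hN0 : (0 : ℝ) < N := by linarith
  set P : ℝ := (N : ℝ) ^ θ₁ with hPdef
  have hP0 : 0 < P := Real.rpow_pos_of_pos hN0 _
  have hlogN : 1 / θ₁ ^ 2 ≤ Real.log N := by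
    have h1 : Real.exp (1 / θ₁ ^ 2) ≤ N := (Nat.le_ceil _).trans (by exact_mod_cast hNexp)
    have := Real.log_le_log (Real.exp_pos _) h1
    rwa [Real.log_exp] at this
  have hexp : Real.exp (Real.sqrt (Real.log N)) ≤ P := exp_sqrt_log_le_rpow hN1 hθ₁ hlogN
  have hPc₄ : P ≤ (N : ℝ) ^ c₄ := Real.rpow_le_rpow_of_exponent_le hN1 hθ₁c₄
  have hP4 : 4 ≤ P := by
    have h1 : (4 : ℝ) ^ (1 / θ₁) ≤ N := (Nat.le_ceil _).trans (by exact_mod_cast hN4)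
    have h2 : ((4 : ℝ) ^ (1 / θ₁)) ^ θ₁ ≤ P := Real.rpow_le_rpow (by positivity) h1 hθ₁.le
    rwa [← Real.rpow_mul (by norm_num), one_div_mul_cancel hθ₁.ne', Real.rpow_one] at h2
  -- Gallagher's first clause at `x = h = N`: no datum is exceptional at `(c, P)`
  have key := (hC N P hN2 hexp hPc₄ (fun _ _ => N) (fun _ _ => N) (fun _ _ => le_rfl)
    (fun _ _ => le_rfl)).1 (fun r _ χ β => hE c hc (min_le_right _ _) P hP4 r χ β)
  have hlog : -c * Real.log N / Real.log P = -c / θ₁ := by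
    have hlogN0 : 0 < Real.log N := Real.log_pos (by exact_mod_cast (show 1 < N by omega))
    rw [hPdef, Real.log_rpow hN0]
    field_simp
  rw [hlog] at key
  -- embed the characters mod `d` into the primitive characters of conductor `≤ P`
  have hNP : 0 < (N : ℝ) + N / P := by positivity
  have hemb := PrimesInAPGallagher.sum_conductor_primitiveCharacter_le_filter hdP
    (fun q ψ => ((N : ℝ) + N / P)⁻¹ * ‖gallagherTerm ψ N N‖) (fun q ψ => by positivity)
    (fun q ψ => ψ.IsPrimitive) (fun q => inferInstance) (fun χ => χ.primitiveCharacter_isPrimitive)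
  have hbound : ∑ χ : DirichletCharacter ℂ d,
      ((N : ℝ) + N / P)⁻¹ * ‖gallagherTerm χ.primitiveCharacter N N‖ ≤ C * Real.exp (-c / θ₁) := by
    refine hemb.trans ?_
    convert key using 2
  have hsum : ∑ χ : DirichletCharacter ℂ d, ‖gallagherTerm χ.primitiveCharacter N N‖ =
      ((N : ℝ) + N / P) * ∑ χ : DirichletCharacter ℂ d,
        ((N : ℝ) + N / P)⁻¹ * ‖gallagherTerm χ.primitiveCharacter N N‖ := by
    rw [Finset.mul_sum]
    refine Finset.sum_congr rfl fun χ _ => ?_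
    rw [← mul_assoc, mul_inv_cancel₀ hNP.ne', one_mul]
  -- unweight: `N + N/P ≤ 2N`
  have hE0 : 0 < Real.exp (-c / θ₁) := Real.exp_pos _
  have hP1 : 1 ≤ P := by linarith
  have hNP2 : (N : ℝ) + N / P ≤ 2 * N := by
    have : (N : ℝ) / P ≤ N := div_le_self hN0.le hP1
    linarith
  have hCK : C ≤ max C 0 + 1 := by have := le_max_left C 0; linarith
  rw [hsum]
  calc ((N : ℝ) + N / P) * ∑ χ : DirichletCharacter ℂ d,
        ((N : ℝ) + N / P)⁻¹ * ‖gallagherTerm χ.primitiveCharacter N N‖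
      ≤ (2 * N) * (C * Real.exp (-c / θ₁)) :=
        mul_le_mul hNP2 hbound (Finset.sum_nonneg fun χ _ => by positivity) (by positivity)
    _ ≤ (2 * N) * ((max C 0 + 1) * Real.exp (-c / θ₁)) := by
        gcongr
    _ = 2 * (max C 0 + 1) * Real.exp (-c / θ₁) * N := by ring

end Summit.Parity.GeneralizedHardyLittlewood.Cruxes.RelativeDimOne.FloatingLevelCore

end
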